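import Summits.CriticalPhenomena.Ising3DConformalLimit.Theses.SynchronousCoupling
import Summits.CriticalPhenomena.Ising3DConformalLimit.Theorems.HyperoctahedralRPExistsScaleCovariantLimitBlockLimitsGiveCrux
import Summits.CriticalPhenomena.Ising3DConformalLimit.Theorems.HyperoctahedralRPExistsScaleCovariantLimitCruxIffOrbitPrecompactPointwiseLimit
import Summits.CriticalPhenomena.Ising3DConformalLimit.Theorems.HyperoctahedralRPExistsScaleCovariantLimitCompactnessItemMapsDoubling
import Summits.CriticalPhenomena.Ising3DConformalLimit.Theorems.HyperoctahedralRPLimitRotationInvariant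
import Summits.CriticalPhenomena.Ising3DConformalLimit.Theorems.HyperoctahedralRPHRP2Rigidity
import Summits.CriticalPhenomena.Ising3DConformalLimit.Theorems.SynchronousCouplingJoiningsTransferTwoBaseCroft
import Summits.CriticalPhenomena.Ising3DConformalLimit.Theorems.SynchronousCouplingJoiningsTransferMomentDiff
import Summits.CriticalPhenomena.Ising3DConformalLimit.Theorems.SynchronousCouplingJoiningsTransferBlockModel
import Summits.CriticalPhenomena.Ising3DConformalLimit.Theorems.SynchronousCouplingJoiningsTransferBallSumRatio
import Summits.CriticalPhenomena.Ising3DConformalLimit.Theorems.SynchronousCouplingJoiningsTransferSlabVariance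
import Summits.CriticalPhenomena.Ising3DConformalLimit.Theorems.SynchronousCouplingJoiningsTransferTowerCauchy
import HarnessLib

/-!
# Skeleton of line `Sketch` for crux `JoiningsTransfer` (stmt-CriticalPhenomena-18764, route SynchronousCoupling)

Card `Cruxes/JoiningsTransfer/Ideas/towers-to-all-scales-croft.md`.  The crux is
`DilationJoinings → RotationJoining → UniformRegularity → (PL) ∧ (ROT)`; (ROT) is in tree
(`LimitRotationInvariant_of HRP2Rigidity_of`), (PL) = item 6153 follows from `MonotoneBlockingPort.BlockLimits` by the landed
funnel `ExistsScaleCovariantLimit_of_blockLimits` + `pointwiseLimit_of_existsScaleCovariantLimit`.  So the line proves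
`DilationJoinings → UniformRegularity → BlockLimits` ("every normalised block moment `R_n(L;k) = critBlockMoment n L k`
converges as `L → ∞`") from seven registered stubs:

* A `stub_twoBaseCroft` — pure real analysis: base-uniform 2- and 3-tower rates + log-continuity ⇒ convergence.
* B `stub_momentDiff` — pure measure theory: `|E∏Yᵢ − E∏Zᵢ| ≤ n √η √M` from `E(Yᵢ−Zᵢ)² ≤ η` and `2(n−1)`-th moments `≤ M`.
* C `stub_blockModel` — model identification: a translation-invariant critical Gibbs PROBABILITY measure `μ` computing
  `criticalCorr`, `V(L) = blockCov L 0` and `critBlockMoment` as integrals of (normalised) block spins.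
* D `stub_towerCauchy` — B → C → DilationJoinings → tower rates for every `R_n(·;k)` (lead).
* E1 `stub_ballSumRatio` — `L³ S(cL) ≤ A V(L)` eventually (`S(R) = Σ_{z ∈ box 3 R} ⟨σ₀σ_z⟩`), given TwoPointDoubling.
* E2 `stub_slabVariance` — E1 → the two-point mass of the symmetric difference of the blocks at sides `L ≤ L' ≤ (1+s)L` is
  `≤ ε V(L)`.
* E3 `stub_logContinuity` — B → C → E2 → log-continuity of every `R_n(·;k)`.

Glue: `blockLimits_of`, `JoiningsTransfer_of`, `JoiningsTransfer_proof`.  `RotationJoining` is unused (ROT is in tree).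
-/

noncomputable section

namespace Summit.CriticalPhenomena.Ising3DConformalLimit.Cruxes.JoiningsTransfer.Sketch

open Literature.Probability.LatticeModels MeasureTheory Filter Set
open scoped Topology BigOperators
open Summit.CriticalPhenomena.Ising3DConformalLimit.Theses
open Summit.CriticalPhenomena.Ising3DConformalLimit.Cruxes.ExistsScaleCovariantLimit.MonotoneBlockingPort
open Summit.CriticalPhenomena.Ising3DConformalLimit.Cruxes.ExistsScaleCovariantLimit.TwoHierarchies
  (pointwiseLimit_of_existsScaleCovariantLimit)
open Summit.CriticalPhenomena.Ising3DConformalLimit.Cruxes.ExistsScaleCovariantLimit.TwoHierarchies.ItemMaps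
  (uniformRegularity_iff_doubling)
open Summit.CriticalPhenomena.Ising3DConformalLimit.Cruxes.LimitRotationInvariant.QuarterTurnLiouville
  (LimitRotationInvariant_of)
open Summit.CriticalPhenomena.Ising3DConformalLimit.Cruxes.HRP2Rigidity.XRayMellin (HRP2Rigidity_of)

/-! ## Statements (documentation copies; the registered stubs below carry the same text inline) -/

/-- A. Two-base Croft lemma for bare sequences. -/
def Sig.TwoBaseCroft : Prop :=
  ∀ R : ℕ → ℝ,
    (∃ C θ : ℝ, 0 < θ ∧ ∀ L : ℕ, 1 ≤ L →
      |R (2 * L) - R L| ≤ C * (L : ℝ) ^ (-θ) ∧ |R (3 * L) - R L| ≤ C * (L : ℝ) ^ (-θ)) →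
    (∀ ε : ℝ, 0 < ε → ∃ s : ℝ, 0 < s ∧ ∃ L₀ : ℕ, ∀ L L' : ℕ, L₀ ≤ L → L ≤ L' →
      (L' : ℝ) ≤ (1 + s) * L → |R L' - R L| ≤ ε) →
    ∃ M : ℝ, Tendsto R atTop (𝓝 M)

/-- B. Moment-difference inequality. -/
def Sig.MomentDiff : Prop :=
  ∀ (Ω : Type) [MeasurableSpace Ω] (P : Measure Ω) [IsProbabilityMeasure P] (n : ℕ)
    (Y Z : Fin n → Ω → ℝ) (M η : ℝ),
    (∀ i, Measurable (Y i)) → (∀ i, Measurable (Z i)) →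
    (∀ i, ∃ B : ℝ, ∀ ω, |Y i ω| ≤ B ∧ |Z i ω| ≤ B) →
    (∀ i, ∫ ω, (Y i ω) ^ (2 * (n - 1)) ∂P ≤ M) → (∀ i, ∫ ω, (Z i ω) ^ (2 * (n - 1)) ∂P ≤ M) →
    (∀ i, ∫ ω, (Y i ω - Z i ω) ^ 2 ∂P ≤ η) →
    |(∫ ω, ∏ i, Y i ω ∂P) - ∫ ω, ∏ i, Z i ω ∂P| ≤ n * Real.sqrt η * Real.sqrt M

/-- C. Block model identification. -/
def Sig.BlockModel : Prop :=
  ∃ μ : Measure (SpinConfig (Site 3)),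
    μ ∈ isingGibbsMeasures 3 (criticalBeta 3) 0 ∧ IsTranslationInvariantMeasure μ ∧ IsProbabilityMeasure μ ∧
    (∀ (n : ℕ) (y : Fin n → Site 3), criticalCorr 3 n y = ∫ σ, spinMonomial y σ ∂μ) ∧
    (∀ L : ℕ, blockCov L 0 = ∫ σ, (∑ x ∈ cube L, spinAt x σ) ^ 2 ∂μ) ∧
    (∀ (n L : ℕ) (k : Fin n → Site 3), critBlockMoment n L k =
      ∫ σ, ∏ i, ((Real.sqrt (blockCov L 0))⁻¹ * ∑ x ∈ cube L, spinAt (x + (L : ℤ) • k i) σ) ∂μ)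

/-- D (conclusion). Tower rates. -/
def Sig.Towers : Prop :=
  ∀ (n : ℕ) (k : Fin n → Site 3), ∃ C θ : ℝ, 0 < θ ∧ ∀ L : ℕ, 1 ≤ L →
    |critBlockMoment n (2 * L) k - critBlockMoment n L k| ≤ C * (L : ℝ) ^ (-θ) ∧
    |critBlockMoment n (3 * L) k - critBlockMoment n L k| ≤ C * (L : ℝ) ^ (-θ)

/-- E1 (conclusion). Ball-sum ratio. -/
def Sig.BallSumRatio : Prop :=
  ∀ c : ℕ, ∃ A : ℝ, ∃ L₀ : ℕ, 1 ≤ L₀ ∧ ∀ L : ℕ, L₀ ≤ L →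
    (L : ℝ) ^ 3 * ∑ z ∈ box 3 (c * L), criticalTwoPoint 3 z ≤ A * blockCov L 0

/-- E2 (conclusion). Slab variance. -/
def Sig.SlabVariance : Prop :=
  ∀ (k : Site 3) (ε : ℝ), 0 < ε → ∃ s : ℝ, 0 < s ∧ ∃ L₀ : ℕ, 1 ≤ L₀ ∧ ∀ L L' : ℕ, L₀ ≤ L → L ≤ L' →
    (L' : ℝ) ≤ (1 + s) * L →
    ∑ x ∈ symmDiff ((cube L').image (fun x => x + (L' : ℤ) • k)) ((cube L).image (fun x => x + (L : ℤ) • k)),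
      ∑ y ∈ symmDiff ((cube L').image (fun x => x + (L' : ℤ) • k)) ((cube L).image (fun x => x + (L : ℤ) • k)),
        criticalTwoPoint 3 (y - x) ≤ ε * blockCov L 0

/-- E3 (conclusion). Log-continuity. -/
def Sig.LogContinuity : Prop :=
  ∀ (n : ℕ) (k : Fin n → Site 3) (ε : ℝ), 0 < ε → ∃ s : ℝ, 0 < s ∧ ∃ L₀ : ℕ, ∀ L L' : ℕ, L₀ ≤ L → L ≤ L' →
    (L' : ℝ) ≤ (1 + s) * L → |critBlockMoment n L' k - critBlockMoment n L k| ≤ ε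

/-! ## Registered stubs (inline signatures) -/

-- Stub A `stub_twoBaseCroft` LANDED (p159328, Theorems/SynchronousCouplingJoiningsTransferTwoBaseCroft.lean).
-- Stub B `stub_momentDiff` LANDED (p159482, Theorems/SynchronousCouplingJoiningsTransferMomentDiff.lean).
-- Stub C `stub_blockModel` LANDED (p159101, Theorems/SynchronousCouplingJoiningsTransferBlockModel.lean).
-- Stub D `stub_towerCauchy` LANDED (p159120, Theorems/SynchronousCouplingJoiningsTransferTowerCauchy.lean).
-- Stub E1 `stub_ballSumRatio` LANDED (p159293, Theorems/SynchronousCouplingJoiningsTransferBallSumRatio.lean).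
-- Stub E2 `stub_slabVariance` LANDED (p159381, Theorems/SynchronousCouplingJoiningsTransferSlabVariance.lean).

/-- **Stub E3** (log-continuity assembly). -/
theorem stub_logContinuity :
    (∀ (Ω : Type) [MeasurableSpace Ω] (P : Measure Ω) [IsProbabilityMeasure P] (n : ℕ)
      (Y Z : Fin n → Ω → ℝ) (M η : ℝ),
      (∀ i, Measurable (Y i)) → (∀ i, Measurable (Z i)) →
      (∀ i, ∃ B : ℝ, ∀ ω, |Y i ω| ≤ B ∧ |Z i ω| ≤ B) →
      (∀ i, ∫ ω, (Y i ω) ^ (2 * (n - 1)) ∂P ≤ M) → (∀ i, ∫ ω, (Z i ω) ^ (2 * (n - 1)) ∂P ≤ M) →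
      (∀ i, ∫ ω, (Y i ω - Z i ω) ^ 2 ∂P ≤ η) →
      |(∫ ω, ∏ i, Y i ω ∂P) - ∫ ω, ∏ i, Z i ω ∂P| ≤ n * Real.sqrt η * Real.sqrt M) →
    (∃ μ : Measure (SpinConfig (Site 3)),
      μ ∈ isingGibbsMeasures 3 (criticalBeta 3) 0 ∧ IsTranslationInvariantMeasure μ ∧ IsProbabilityMeasure μ ∧
      (∀ (n : ℕ) (y : Fin n → Site 3), criticalCorr 3 n y = ∫ σ, spinMonomial y σ ∂μ) ∧
      (∀ L : ℕ, blockCov L 0 = ∫ σ, (∑ x ∈ cube L, spinAt x σ) ^ 2 ∂μ) ∧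
      (∀ (n L : ℕ) (k : Fin n → Site 3), critBlockMoment n L k =
        ∫ σ, ∏ i, ((Real.sqrt (blockCov L 0))⁻¹ * ∑ x ∈ cube L, spinAt (x + (L : ℤ) • k i) σ) ∂μ)) →
    (∀ (k : Site 3) (ε : ℝ), 0 < ε → ∃ s : ℝ, 0 < s ∧ ∃ L₀ : ℕ, 1 ≤ L₀ ∧ ∀ L L' : ℕ, L₀ ≤ L → L ≤ L' →
      (L' : ℝ) ≤ (1 + s) * L →
      ∑ x ∈ symmDiff ((cube L').image (fun x => x + (L' : ℤ) • k)) ((cube L).image (fun x => x + (L : ℤ) • k)),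
        ∑ y ∈ symmDiff ((cube L').image (fun x => x + (L' : ℤ) • k)) ((cube L).image (fun x => x + (L : ℤ) • k)),
          criticalTwoPoint 3 (y - x) ≤ ε * blockCov L 0) →
    ∀ (n : ℕ) (k : Fin n → Site 3) (ε : ℝ), 0 < ε → ∃ s : ℝ, 0 < s ∧ ∃ L₀ : ℕ, ∀ L L' : ℕ, L₀ ≤ L → L ≤ L' →
      (L' : ℝ) ≤ (1 + s) * L → |critBlockMoment n L' k - critBlockMoment n L k| ≤ ε := by
  sorry

/-! ## Glue (sorry-free) -/

/-- The hypothesis `UniformRegularity` of this route is item 4658 verbatim, i.e. `MonotoneRG.UniformRegularity`. -/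
theorem uniformRegularity_iff : SynchronousCoupling.UniformRegularity ↔ MonotoneRG.UniformRegularity := Iff.rfl

/-- GLUE: the seven stubs give `DilationJoinings → UniformRegularity → BlockLimits`. -/
theorem blockLimits_of (hA : Sig.TwoBaseCroft) (hB : Sig.MomentDiff) (hC : Sig.BlockModel)
    (hD : Sig.MomentDiff → Sig.BlockModel → SynchronousCoupling.DilationJoinings → Sig.Towers)
    (hE1 : MirrorHoelderCompactness.TwoPointDoubling → Sig.BallSumRatio)
    (hE2 : Sig.BallSumRatio → Sig.SlabVariance)
    (hE3 : Sig.MomentDiff → Sig.BlockModel → Sig.SlabVariance → Sig.LogContinuity)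
    (hDJ : SynchronousCoupling.DilationJoinings) (hUR : SynchronousCoupling.UniformRegularity) : BlockLimits := by
  intro n _hn k _hk
  have hdoub : MirrorHoelderCompactness.TwoPointDoubling :=
    uniformRegularity_iff_doubling.1 (uniformRegularity_iff.1 hUR)
  exact hA (fun L => critBlockMoment n L k) ((hD hB hC hDJ) n k)
    ((hE3 hB hC (hE2 (hE1 hdoub))) n k)

/-- GLUE: the seven stubs give the crux. `RotationJoining` is unused: (ROT) is the tree's
`LimitRotationInvariant_of HRP2Rigidity_of`; (PL) is the landed funnel applied to `BlockLimits`. -/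
theorem JoiningsTransfer_of (hA : Sig.TwoBaseCroft) (hB : Sig.MomentDiff) (hC : Sig.BlockModel)
    (hD : Sig.MomentDiff → Sig.BlockModel → SynchronousCoupling.DilationJoinings → Sig.Towers)
    (hE1 : MirrorHoelderCompactness.TwoPointDoubling → Sig.BallSumRatio)
    (hE2 : Sig.BallSumRatio → Sig.SlabVariance)
    (hE3 : Sig.MomentDiff → Sig.BlockModel → Sig.SlabVariance → Sig.LogContinuity) :
    Summit.CriticalPhenomena.Ising3DConformalLimit.Theses.SynchronousCoupling.JoiningsTransfer := by
  intro hDJ _hRJ hUR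
  exact ⟨pointwiseLimit_of_existsScaleCovariantLimit
      (ExistsScaleCovariantLimit_of_blockLimits (blockLimits_of hA hB hC hD hE1 hE2 hE3 hDJ hUR)),
    LimitRotationInvariant_of HRP2Rigidity_of⟩

/-- The crux, modulo the seven registered stubs. -/
theorem JoiningsTransfer_proof :
    Summit.CriticalPhenomena.Ising3DConformalLimit.Theses.SynchronousCoupling.JoiningsTransfer :=
  JoiningsTransfer_of stub_twoBaseCroft stub_momentDiff stub_blockModel stub_towerCauchy stub_ballSumRatio
    stub_slabVariance stub_logContinuity

end Summit.CriticalPhenomena.Ising3DConformalLimit.Cruxes.JoiningsTransfer.Sketch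

end
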